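import Summits.CriticalPhenomena.PercolationContinuityZ3.Theorems.Transplant.FKConnectivityAllQTwoClusterRayleighGradedRC
import Literature.Probability.LatticeModels.RandomClusterEdgeWeightsConditioning
import HarnessLib

/-!
# Conjecture R_q read on ONE random-cluster measure (kernel): under `φ_{w,q}` CONDITIONED ON `a ↮ c`, the edge `av` and the edge `cy` are
# NEGATIVELY CORRELATED, for every `q > 0` and all edge weights — `φ(D ∩ e f)·φ(D ∩ ēf̄) ≤ φ(D ∩ e f̄)·φ(D ∩ ē f)`, `D = {a ↮ c}`

Support file (`--supports stmt-CriticalPhenomena-4575`), FK sub-lane `prim-bschramm-fk-1` (gen 16) of the post-continuity programme;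
builds on p205010 (kernel theorem, internal audit signed; external expert review pending).  No definitions, no named facts, no sorries;
standard axioms.

THE STEP.  `…TwoClusterRayleighGradedRC.lean` derives from the node `TwoClusterRayleighGradedOn V` the inequality
`Z₁₁(q)Z₀₀(q) ≤ Z₁₀(q)Z₀₁(q)` between the `{a ↮ c}`-restricted masses of the FOUR PINNED weight vectors `w[e↦i][f↦j]`.  Grimmett's
Thm. (3.7) in pointwise form (tree: `rcWeightW_mul_ind_cylinder`) says that on the cylinder `{ω ∩ {e,f} = ξ}` the weight of ONE measure
`φ_{w,q}` factorises as `offWeight(ξ) × (weight for the pinned vector)`, and `offWeight(ef)·offWeight(∅) = w_e w_f (1−w_e)(1−w_f) =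
offWeight(e)·offWeight(f)` (`offWeight_pair_mul`); so the four-world inequality is EQUIVALENT (for `0 < w_e, w_f < 1`) to the 2 × 2 inequality
for the single measure: **`rc_edgeNegCorr_of_gradedOn`**: for `φ = rcMeasureW w q ∅`, `D = sepEv a c`, `e = av`, `f = cy`,
`φ(D ∩ {e, f open})·φ(D ∩ {e, f closed}) ≤ φ(D ∩ {e open, f closed})·φ(D ∩ {e closed, f open})`, i.e. `Cov_{φ(·|D)}(ω_e, ω_f) ≤ 0`.
This is van den Berg–Häggström–Kahn's Thm. 1.4 for `φ_{w,q}` with `F = 1{e ∈ C_a}`, `G = 1{f ∈ C_c}` (the node `FKCrossNegAssocOn V q` of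
fk-1 g14 read on two edges): a THEOREM for `q ≥ 1` (`fkCrossNegAssocOn_of_one_le`), conjectural for `q < 1`; here it is obtained for EVERY
`q > 0` from Conjecture R_q (which asserts it coefficientwise in `q`, with the square term).  Nothing is asserted: the node is a hypothesis.
[cite: VandenbergHaggstromKahn2005, Thm. 1.4 (p. 7); Thm. 2.1 (p. 9)] [cite: Grimmett2006, Thm. (3.7) (p. 39); §1.4 eq. (1.20) (p. 15); §3.9 eq. (3.94) (p. 63)]
-/

noncomputable section

namespace Summit.CriticalPhenomena.PercolationContinuityZ3.Theorems

namespace FK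

open MeasureTheory Set Literature.Probability.LatticeModels Literature.Probability.Percolation
open Literature.Probability.Percolation.BHK2006 (weight weight_nonneg ind_inter)
open Literature.Probability.Percolation.DecisionTree (ind ind_of_mem ind_of_not_mem ind_nonneg)
open scoped Classical

variable {V : Type*} [Fintype V]

/-! ### The cylinder factorisation, unnormalised -/

/-- **Thm. (3.7), unnormalised**: `φ_w(A ∩ {ω ∖ F = ξ})·Z_w = offWeight(F, ξ)·(φ_{w'}(A)·Z_{w'})` with `w' = condWeights w F ξ`.
[cite: Grimmett2006, Thm. (3.7) (p. 39); §1.4 eq. (1.20) (p. 15)] -/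
theorem rc_real_inter_cylinder_mul_Z (w : Sym2 V → unitInterval) {q : ℝ} (hq : 0 < q) {F ξ : Set (Sym2 V)} (hξ : Disjoint ξ F)
    (A : Set (BondConfig V)) :
    (rcMeasureW w q ∅).real (A ∩ {ω : BondConfig V | ω \ F = ξ}) * rcPartitionFunctionW w q ∅ =
      offWeight w F ξ * ((rcMeasureW (condWeights w F ξ) q ∅).real A * rcPartitionFunctionW (condWeights w F ξ) q ∅) := by
  have hZ := rcPartitionFunctionW_pos w hq (∅ : Set V)
  have hZ' := rcPartitionFunctionW_pos (condWeights w F ξ) hq (∅ : Set V)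
  rw [rcMeasureW_real_eq_sum_div w hq ∅, rcMeasureW_real_eq_sum_div (condWeights w F ξ) hq ∅, div_mul_cancel₀ _ hZ.ne',
    div_mul_cancel₀ _ hZ'.ne', Finset.mul_sum]
  refine Finset.sum_congr rfl fun ω _ => ?_
  rw [ind_inter, ← mul_assoc, mul_right_comm, rcWeightW_mul_ind_cylinder w q ∅ hξ ω]
  ring

/-! ### Two pinned pairs: the conditional weight vectors and the off-weights -/

omit [Fintype V] in
/-- `condWeights w {e,f}ᶜ ξ = w[e ↦ 1{e ∈ ξ}][f ↦ 1{f ∈ ξ}]` (as the pinned vectors of the lineage), `e ≠ f`.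
[cite: Grimmett2006, Thm. (3.7) (p. 39)] -/
theorem condWeights_pair (w : Sym2 V → unitInterval) {e f : Sym2 V} (hef : e ≠ f) (ξ : Set (Sym2 V)) :
    condWeights w ({e, f} : Set (Sym2 V))ᶜ ξ =
      Function.update (Function.update w e (if e ∈ ξ then 1 else 0)) f (if f ∈ ξ then 1 else 0) := by
  funext g
  unfold condWeights
  by_cases hgf : g = f
  · subst hgf
    simp [Function.update_self]
  · by_cases hge : g = e
    · subst hge
      rw [Function.update_of_ne hgf, Function.update_self]
      simp
    · rw [Function.update_of_ne hgf, Function.update_of_ne hge]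
      have hg : g ∈ ({e, f} : Set (Sym2 V))ᶜ := by simp [hge, hgf]
      rw [if_pos hg]

/-- **`offWeight(ef)·offWeight(∅) = offWeight(e)·offWeight(f)`** for the region `F = {e,f}ᶜ` (both equal `w_e w_f (1−w_e)(1−w_f)`), `e ≠ f`.
[cite: Grimmett2006, Thm. (3.7) (p. 39)] -/
theorem offWeight_pair_mul (w : Sym2 V → unitInterval) {e f : Sym2 V} (hef : e ≠ f) :
    offWeight w ({e, f} : Set (Sym2 V))ᶜ ({e, f} : Set (Sym2 V)) * offWeight w ({e, f} : Set (Sym2 V))ᶜ (∅ : Set (Sym2 V)) =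
      offWeight w ({e, f} : Set (Sym2 V))ᶜ ({e} : Set (Sym2 V)) * offWeight w ({e, f} : Set (Sym2 V))ᶜ ({f} : Set (Sym2 V)) := by
  unfold offWeight
  rw [← Finset.prod_mul_distrib, ← Finset.prod_mul_distrib]
  refine Finset.prod_congr rfl fun g _ => ?_
  by_cases hg : g ∈ ({e, f} : Set (Sym2 V))ᶜ
  · simp only [hg, if_true]
  · rw [if_neg hg, if_neg hg, if_neg hg, if_neg hg]
    have hg' : g ∈ ({e, f} : Set (Sym2 V)) := by rwa [Set.mem_compl_iff, not_not] at hg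
    simp only [mem_insert_iff, mem_singleton_iff] at hg'
    rcases hg' with rfl | rfl
    · simp [hef]
    · simp [Ne.symm hef, mul_comm]

/-! ### The four cylinders as edge events -/

omit [Fintype V] in
/-- `{ω ∖ {e,f}ᶜ = {e,f}} = {e ∈ ω ∧ f ∈ ω}`. [folklore] -/
theorem cyl_pair_both (e f : Sym2 V) :
    {ω : BondConfig V | ω \ ({e, f} : Set (Sym2 V))ᶜ = ({e, f} : Set (Sym2 V))} = {ω | e ∈ ω ∧ f ∈ ω} := by
  ext ω
  simp only [mem_setOf_eq, Set.sdiff_compl, Set.inter_eq_right, Set.insert_subset_iff, Set.singleton_subset_iff]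

omit [Fintype V] in
/-- `{ω ∖ {e,f}ᶜ = ∅} = {e ∉ ω ∧ f ∉ ω}`. [folklore] -/
theorem cyl_pair_none (e f : Sym2 V) :
    {ω : BondConfig V | ω \ ({e, f} : Set (Sym2 V))ᶜ = (∅ : Set (Sym2 V))} = {ω | e ∉ ω ∧ f ∉ ω} := by
  ext ω
  simp only [mem_setOf_eq, Set.sdiff_compl]
  constructor
  · intro h
    exact ⟨fun he => (Set.ext_iff.1 h e).1 ⟨he, by simp⟩, fun hf => (Set.ext_iff.1 h f).1 ⟨hf, by simp⟩⟩
  · rintro ⟨he, hf⟩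
    ext g
    simp only [mem_inter_iff, mem_insert_iff, mem_singleton_iff, mem_empty_iff_false, iff_false, not_and]
    rintro hg (rfl | rfl)
    · exact he hg
    · exact hf hg

omit [Fintype V] in
/-- `{ω ∖ {e,f}ᶜ = {e}} = {e ∈ ω ∧ f ∉ ω}` for `e ≠ f`. [folklore] -/
theorem cyl_pair_fst {e f : Sym2 V} (hef : e ≠ f) :
    {ω : BondConfig V | ω \ ({e, f} : Set (Sym2 V))ᶜ = ({e} : Set (Sym2 V))} = {ω | e ∈ ω ∧ f ∉ ω} := by
  ext ω
  simp only [mem_setOf_eq, Set.sdiff_compl]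
  constructor
  · intro h
    refine ⟨((Set.ext_iff.1 h e).2 rfl).1, fun hf => hef ?_⟩
    have := (Set.ext_iff.1 h f).1 ⟨hf, by simp⟩
    exact (mem_singleton_iff.1 this).symm
  · rintro ⟨he, hf⟩
    ext g
    simp only [mem_inter_iff, mem_insert_iff, mem_singleton_iff]
    constructor
    · rintro ⟨hg, rfl | rfl⟩
      · rfl
      · exact absurd hg hf
    · rintro rfl; exact ⟨he, Or.inl rfl⟩

omit [Fintype V] in
/-- `{ω ∖ {e,f}ᶜ = {f}} = {e ∉ ω ∧ f ∈ ω}` for `e ≠ f`. [folklore] -/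
theorem cyl_pair_snd {e f : Sym2 V} (hef : e ≠ f) :
    {ω : BondConfig V | ω \ ({e, f} : Set (Sym2 V))ᶜ = ({f} : Set (Sym2 V))} = {ω | e ∉ ω ∧ f ∈ ω} := by
  ext ω
  simp only [mem_setOf_eq, Set.sdiff_compl]
  constructor
  · intro h
    refine ⟨fun he => hef ?_, ((Set.ext_iff.1 h f).2 rfl).1⟩
    have := (Set.ext_iff.1 h e).1 ⟨he, by simp⟩
    exact mem_singleton_iff.1 this
  · rintro ⟨he, hf⟩
    ext g
    simp only [mem_inter_iff, mem_insert_iff, mem_singleton_iff]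
    constructor
    · rintro ⟨hg, rfl | rfl⟩
      · exact absurd hg he
      · rfl
    · rintro rfl; exact ⟨hf, Or.inr rfl⟩

/-! ### The edge-level negative correlation given `a ↮ c` -/

/-- **Conjecture R_q ⇒ given `a ↮ c`, the edges `av` and `cy` are negatively correlated under `φ_{w,q}`, every `q > 0`, all `w`**:
`φ(D ∩ {e,f ∈ ω})·φ(D ∩ {e,f ∉ ω}) ≤ φ(D ∩ {e ∈ ω, f ∉ ω})·φ(D ∩ {e ∉ ω, f ∈ ω})`, `φ = rcMeasureW w q ∅`, `D = {a ↮ c}`, `e = av`, `f = cy`.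
[cite: VandenbergHaggstromKahn2005, Thm. 1.4 (p. 7); Thm. 2.1 (p. 9)] [cite: Grimmett2006, Thm. (3.7) (p. 39); §3.9 eq. (3.94) (p. 63)] -/
theorem rc_edgeNegCorr_of_gradedOn (h : TwoClusterRayleighGradedOn V) (w : Sym2 V → unitInterval) {q : ℝ} (hq : 0 < q)
    (a c v y : V) :
    (rcMeasureW w q ∅).real (sepEv a c ∩ {ω | s(a, v) ∈ ω ∧ s(c, y) ∈ ω}) *
        (rcMeasureW w q ∅).real (sepEv a c ∩ {ω | s(a, v) ∉ ω ∧ s(c, y) ∉ ω}) ≤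
      (rcMeasureW w q ∅).real (sepEv a c ∩ {ω | s(a, v) ∈ ω ∧ s(c, y) ∉ ω}) *
        (rcMeasureW w q ∅).real (sepEv a c ∩ {ω | s(a, v) ∉ ω ∧ s(c, y) ∈ ω}) := by
  set e : Sym2 V := s(a, v) with he
  set f : Sym2 V := s(c, y) with hf
  by_cases hef : e = f
  · -- `e = f = ac` (or `a = c`): the doubly-open slice of `{a ↮ c}` is empty
    have h0 : (rcMeasureW w q ∅).real (sepEv a c ∩ {ω | e ∈ ω ∧ f ∈ ω}) = 0 := by
      have hempty : sepEv a c ∩ {ω : BondConfig V | e ∈ ω ∧ f ∈ ω} = ∅ := by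
        ext ω
        simp only [mem_inter_iff, mem_sepEv_iff, mem_setOf_eq, mem_empty_iff_false, iff_false, not_and]
        intro hac heω _
        rcases Sym2.eq_iff.1 hef with ⟨hac', _⟩ | ⟨hay, hvc⟩
        · exact hac (hac' ▸ SimpleGraph.Reachable.refl _)
        · refine hac (SimpleGraph.Adj.reachable ?_)
          rw [openGraph, SimpleGraph.fromEdgeSet_adj]
          refine ⟨?_, fun h' => hac (h' ▸ SimpleGraph.Reachable.refl _)⟩
          have : s(a, c) = e := by rw [he, hvc]
          rw [this]; exact heω
      rw [hempty, measureReal_empty]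
    rw [h0, zero_mul]
    exact mul_nonneg measureReal_nonneg measureReal_nonneg
  -- `e ≠ f`: clear denominators and factor every slice through its pinned world
  have hZ := rcPartitionFunctionW_pos w hq (∅ : Set V)
  have hdisj : ∀ ξ : Set (Sym2 V), ξ ⊆ ({e, f} : Set (Sym2 V)) → Disjoint ξ ({e, f} : Set (Sym2 V))ᶜ :=
    fun ξ hξ => Set.disjoint_compl_right_iff_subset.2 hξ
  have c11 := rc_real_inter_cylinder_mul_Z w hq (hdisj {e, f} subset_rfl) (sepEv a c)
  have c00 := rc_real_inter_cylinder_mul_Z w hq (hdisj ∅ (empty_subset _)) (sepEv a c)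
  have c10 := rc_real_inter_cylinder_mul_Z w hq (hdisj {e} (by simp)) (sepEv a c)
  have c01 := rc_real_inter_cylinder_mul_Z w hq (hdisj {f} (by simp)) (sepEv a c)
  rw [cyl_pair_both, condWeights_pair w hef] at c11
  rw [cyl_pair_none, condWeights_pair w hef] at c00
  rw [cyl_pair_fst hef, condWeights_pair w hef] at c10
  rw [cyl_pair_snd hef, condWeights_pair w hef] at c01
  simp only [mem_insert_iff, mem_singleton_iff, or_true, if_true, mem_empty_iff_false, if_false, hef, Ne.symm hef,
    or_false] at c11 c00 c10 c01
  -- the four-world inequality from the node (`u = a`, `x = c`: sure-reachability is reflexivity)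
  have key := rc_seedNegCorr_of_gradedOn h w hq a c a v c y (SimpleGraph.Reachable.refl _) (SimpleGraph.Reachable.refl _)
  have hoff := offWeight_pair_mul w hef
  have o11 := offWeight_nonneg w ({e, f} : Set (Sym2 V))ᶜ ({e, f} : Set (Sym2 V))
  have o00 := offWeight_nonneg w ({e, f} : Set (Sym2 V))ᶜ (∅ : Set (Sym2 V))
  -- multiply the goal by `Z²`
  rw [← mul_le_mul_iff_of_pos_right (mul_pos hZ hZ)]
  calc (rcMeasureW w q ∅).real (sepEv a c ∩ {ω | e ∈ ω ∧ f ∈ ω}) * (rcMeasureW w q ∅).real (sepEv a c ∩ {ω | e ∉ ω ∧ f ∉ ω}) *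
        (rcPartitionFunctionW w q ∅ * rcPartitionFunctionW w q ∅)
      = ((rcMeasureW w q ∅).real (sepEv a c ∩ {ω | e ∈ ω ∧ f ∈ ω}) * rcPartitionFunctionW w q ∅) *
          ((rcMeasureW w q ∅).real (sepEv a c ∩ {ω | e ∉ ω ∧ f ∉ ω}) * rcPartitionFunctionW w q ∅) := by ring
    _ = (offWeight w ({e, f} : Set (Sym2 V))ᶜ ({e, f} : Set (Sym2 V)) * offWeight w ({e, f} : Set (Sym2 V))ᶜ (∅ : Set (Sym2 V))) *
          (((rcMeasureW (Function.update (Function.update w e 1) f 1) q ∅).real (sepEv a c) *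
              rcPartitionFunctionW (Function.update (Function.update w e 1) f 1) q ∅) *
            ((rcMeasureW (Function.update (Function.update w e 0) f 0) q ∅).real (sepEv a c) *
              rcPartitionFunctionW (Function.update (Function.update w e 0) f 0) q ∅)) := by rw [c11, c00]; ring
    _ ≤ (offWeight w ({e, f} : Set (Sym2 V))ᶜ ({e} : Set (Sym2 V)) * offWeight w ({e, f} : Set (Sym2 V))ᶜ ({f} : Set (Sym2 V))) *
          (((rcMeasureW (Function.update (Function.update w e 1) f 0) q ∅).real (sepEv a c) *
              rcPartitionFunctionW (Function.update (Function.update w e 1) f 0) q ∅) *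
            ((rcMeasureW (Function.update (Function.update w e 0) f 1) q ∅).real (sepEv a c) *
              rcPartitionFunctionW (Function.update (Function.update w e 0) f 1) q ∅)) := by
        rw [← hoff]
        exact mul_le_mul_of_nonneg_left key (mul_nonneg o11 o00)
    _ = ((rcMeasureW w q ∅).real (sepEv a c ∩ {ω | e ∈ ω ∧ f ∉ ω}) * rcPartitionFunctionW w q ∅) *
          ((rcMeasureW w q ∅).real (sepEv a c ∩ {ω | e ∉ ω ∧ f ∈ ω}) * rcPartitionFunctionW w q ∅) := by rw [c10, c01]; ring
    _ = (rcMeasureW w q ∅).real (sepEv a c ∩ {ω | e ∈ ω ∧ f ∉ ω}) * (rcMeasureW w q ∅).real (sepEv a c ∩ {ω | e ∉ ω ∧ f ∈ ω}) *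
        (rcPartitionFunctionW w q ∅ * rcPartitionFunctionW w q ∅) := by ring

end FK

end Summit.CriticalPhenomena.PercolationContinuityZ3.Theorems

end
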